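import Summits.AtomisticToContinuum.BoseEinsteinCondensation.Cruxes.StaticResponseBound.Disproof
import Summits.AtomisticToContinuum.BoseEinsteinCondensation.Theorems.StaticResponseBound.Negative.Basic
import Literature.MathematicalPhysics.QuantumManyBody.BoseGasStructureFactor
import HarnessLib

/-!
# drefute g4 — the sector FLOOR is load-bearing in C2β `stub_sectorCauchySchwarz`
# (line `stable-fraction-square-completion`, crux `StaticResponseBound`, stmt-AtomisticToContinuum-12057)

`SectorCauchySchwarzWithoutFloor` = the conclusion `SectorCauchySchwarz` of stub C2β with the
sector-floor hypothesis (`∀ q, E₀ + Δ ≤ E_sec(q) ∨ E₀ + Δ ≤ E_sec(q+k)`) DELETED, everything else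
verbatim.  It is FALSE (`not_sectorCauchySchwarzWithoutFloor`): one free particle (`v = 0`, `N = 1`,
`L = 1`, `k = e₀`), `lam = D = Δ = 1000`; the ECSF hypothesis holds because `|ρ̂_k|² ≡ 1` for one
particle and `E ≥ 0 = E₀`; the conclusion `⟨cos⟩² ≤ (8/1000)·E_Ψ` fails on the one-mode witness
`Ψ_ε = (1 + 2ε cos θ_k)/‖·‖` of `Disproof.lean` §C at `ε = 1/4` (`⟨cos⟩ = 4/9`, `E_Ψ = 4π²/9`).
Uses (imports) the cdisprove seat's `Disproof.lean` §T/§C toolkit (`oneBodyMode`,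
`cosMean_oneBodyMode`, `periodicEnergy_oneBodyMode`, `normC1_sq`, `psq_e0`).  Any proof of C2β must
use the floor on the stiff member of each sector pair (it is what converts the additive constant `D`
of ECSF into a multiple of the excitation energy).  [The ECSF hypothesis is load-bearing for the same
witness with `lam → ∞`; `0 < L` and `k ≠ 0` are NOT load-bearing for C2β as a formal text — see the
g4 report.]
-/

namespace Summit.AtomisticToContinuum.BoseEinsteinCondensation.Cruxes.StaticResponseBound.DrefuteG4

open MeasureTheory
open scoped ENNReal
open Literature.MathematicalPhysics.QuantumManyBody.BoseGas
open Summit.AtomisticToContinuum.BoseEinsteinCondensation.Theorems.StaticResponseBound.Negative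
  (psq cosMean integral_norm_sq_eq_one)
open Summit.AtomisticToContinuum.BoseEinsteinCondensation.Cruxes.StaticResponseBound.Disproof
  (oneBodyMode cosMean_oneBodyMode periodicEnergy_oneBodyMode normC1 normC1_sq normC1_pos e0 e0_ne_zero)

noncomputable section

/-- C2β's conclusion `SectorCauchySchwarz` with the sector-floor hypothesis deleted (verbatim otherwise). -/
def SectorCauchySchwarzWithoutFloor : Prop :=
  ∀ (v : ℝ → ℝ≥0∞) (N : ℕ) (L : ℝ), 0 < L → ∀ (k : Fin 3 → ℤ), k ≠ 0 →
    ∀ (lam D Δ : ℝ), 0 < lam → 0 ≤ D → 0 < Δ →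
    (∀ Φ : PeriodicTrialState N L, periodicEnergy v Φ ≠ ⊤ →
      lam * ∫ X in cellN N L, ‖densityWave N L k X‖ ^ 2 * ‖Φ.ψ X‖ ^ 2 ≤
        (periodicEnergy v Φ).toReal - (periodicGroundStateEnergy v N L).toReal + D) →
    ∀ Ψ : PeriodicTrialState N L, periodicEnergy v Ψ ≠ ⊤ →
      cosMean L k Ψ ^ 2 ≤
        4 * ((1 + D / Δ) / lam) *
          ((periodicEnergy v Ψ).toReal - (periodicGroundStateEnergy v N L).toReal)

/-- For one particle the density wave is a single phase: `|ρ̂_k(X)| = 1`. [folklore] -/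
theorem norm_densityWave_one (L : ℝ) (k : Fin 3 → ℤ) (X : Config 1) :
    ‖densityWave 1 L k X‖ = 1 := by
  unfold densityWave
  rw [Fin.sum_univ_one, Complex.norm_exp]
  simp

/-- Hence `⟨|ρ̂_k|²⟩_Φ = 1` for every normalised one-particle state. [folklore] -/
theorem integral_densityWave_sq_one (L : ℝ) (k : Fin 3 → ℤ) (Φ : PeriodicTrialState 1 L) :
    ∫ X in cellN 1 L, ‖densityWave 1 L k X‖ ^ 2 * ‖Φ.ψ X‖ ^ 2 = 1 := by
  simp_rw [norm_densityWave_one, one_pow, one_mul]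
  exact integral_norm_sq_eq_one Φ

/-- The two `psq`/`cosMean` copies (Disproof work file vs landed `Negative.Basic`) agree definitionally. -/
theorem disproof_psq_eq (L : ℝ) (k : Fin 3 → ℤ) : Disproof.psq L k = psq L k := rfl

/-- Same for `cosMean`. [folklore] -/
theorem disproof_cosMean_eq {N : ℕ} (L : ℝ) (k : Fin 3 → ℤ) (Ψ : PeriodicTrialState N L) :
    Disproof.cosMean L k Ψ = cosMean L k Ψ := rfl

/-- **The floor is load-bearing in C2β.** [folklore] -/
theorem not_sectorCauchySchwarzWithoutFloor : ¬ SectorCauchySchwarzWithoutFloor := by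
  intro h
  have hL : (0 : ℝ) < 1 := one_pos
  have hε : |(1 / 4 : ℝ)| < 1 / 2 := by rw [abs_of_pos (by norm_num)]; norm_num
  set Ψ : PeriodicTrialState 1 1 := oneBodyMode hL e0 hε with hΨdef
  have hE := periodicEnergy_oneBodyMode hL e0_ne_zero hε (0 : ℝ → ℝ≥0∞)
  have hc2 := normC1_sq hL e0_ne_zero (1 / 4 : ℝ)
  have hcos := cosMean_oneBodyMode hL e0_ne_zero hε
  rw [disproof_cosMean_eq] at hcos
  have hpsq : Disproof.psq 1 e0 = 4 * Real.pi ^ 2 := by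
    rw [Disproof.psq_e0]; ring
  -- the energy is finite and equals `c² · 2ε²|p|²`
  have hEfin : periodicEnergy 0 Ψ ≠ ⊤ := by rw [hΨdef, hE]; exact ENNReal.ofReal_ne_top
  have hEval : (periodicEnergy 0 Ψ).toReal = normC1 1 e0 (1 / 4) ^ 2 *
      (2 * (1 / 4) ^ 2 * Disproof.psq 1 e0 * 1 ^ 3) := by
    rw [hΨdef, hE, ENNReal.toReal_ofReal]
    have := Disproof.psq_nonneg 1 e0
    positivity
  have hE0 : periodicGroundStateEnergy (0 : ℝ → ℝ≥0∞) 1 1 = 0 := periodicGroundStateEnergy_one hL 0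
  -- instantiate the floor-less statement at lam = D = Δ = 1000
  have key := h 0 1 1 hL e0 e0_ne_zero 1000 1000 1000 (by norm_num) (by norm_num) (by norm_num)
    (fun Φ _ => by
      rw [integral_densityWave_sq_one, hE0, ENNReal.toReal_zero, sub_zero, mul_one]
      linarith [ENNReal.toReal_nonneg (a := periodicEnergy 0 Φ)])
    Ψ hEfin
  rw [hE0, ENNReal.toReal_zero, sub_zero, hEval, hcos, hc2, hpsq] at key
  -- key : ((c²)·(2ε))² ≤ 4((1+1000/1000)/1000)·(c²·(2ε²·4π²)), c² = (1+2ε²)⁻¹, ε = 1/4: false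
  have hpi : Real.pi ^ 2 < 16 := by nlinarith [Real.pi_lt_four, Real.pi_pos]
  norm_num at key
  nlinarith [key, hpi, Real.pi_pos]

end

end Summit.AtomisticToContinuum.BoseEinsteinCondensation.Cruxes.StaticResponseBound.DrefuteG4
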